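import Summits.BirchSwinnertonDyer.BirchSwinnertonDyer.Theorems.ManinLocalTwoThreeEulerRemaindersTwentyFour
import Summits.BirchSwinnertonDyer.BirchSwinnertonDyer.Theorems.ManinLocalTwoThreeNeronSqueezeTwentyFour
import Summits.BirchSwinnertonDyer.BirchSwinnertonDyer.Theorems.ManinLocalTwoThreeLigozatIdentitiesThirtySix
import HarnessLib

/-!
# The `η`-identities at level 24 and `|c| = 1` on `X₀(24)` — unconditionally (the second non-CM level, by the Néron squeeze)

Cell bsd-f2-manin, route `ManinLocalTwoThree` (crux C2 `ManinOddAtFour` stmt-22967: `2² ∣ 24`), prover seat p2 gen 26 = the hand of -an g50's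
TURNKEY T-an-g50-24 (LEAD 14:39:09Z).  We discharge the three `q`-asymptotics at `i∞` of `LevelTwentyFour.abs_maninConstant_eq_one_twentyFour_of_tendsto`:

  (T1) `((2πi)⁻¹x′ + φ₂₄·2y)/q → 0`,  (T2) `((2πi)⁻¹y′ + φ₂₄(3x² − 2x − 4))/q → 0`,  (T3) `x³ − x² − 4x + 4 − y² → 0`,

for `x = η₆³η₈/(η₂η₂₄³) = E₆³E₈/(q²E₂E₂₄³)`, `y = η₄η₈²η₁₂⁵/(η₂η₆η₂₄⁶) = E₄E₈²E₁₂⁵/(q³E₂E₆E₂₄⁶)`, `φ₂₄ = qE₂E₄E₆E₁₂` (Euler forms and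
logarithmic derivatives: p3 g23's `EulerRemaindersTwentyFour`; `E₂`: p3's `EulerRemaindersTwenty`; `E₆`: `LigozatIdentitiesThirtySix`), by p3's remainder
calculus at `m = 6` (`E₂ ≡ 1 − q² − q⁴`, `E₄ ≡ 1 − q⁴`, `E₆ ≡ 1 − q⁶`, `E₈ ≡ E₁₂ ≡ E₂₄ ≡ 1`, `(2πi)⁻¹E₂′ ≡ −2q² − 4q⁴`, `(2πi)⁻¹E₄′ ≡ −4q⁴`,
`(2πi)⁻¹E₆′ ≡ −6q⁶`; each target is `G/(q^k · unit)` with the truncation of `G` divisible by `q⁷`, witness checked by `ring`; exact certificate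
seat folder `scripts/trunc24.py`).  CONSEQUENCES (§2): `y² = x³ − x² − 4x + 4` (Cremona's `24a1` LITERALLY), `x′ = −2πiφ₂₄·2y`,
`y′ = −2πiφ₂₄(3x² − 2x − 4)` on `ℍ`; (S2)₂₄ `Λ(φ₂₄) ⊆ Λ_Néron(24a1) = Λ(52/3, −280/27)`; and **`|D.maninConstant| = 1` for every globally minimal
elliptic `W/ℚ` and every `X₀(24)`-datum `D` of `W` with the lattice clause** — no CM, no modularity, no CDT, no printed Manin fact — hence `2 ∤ c`:
the crux C2 AT `N = 24` with none of its fact hypotheses.  BSD is not proved; C2 (all levels) OPEN as filed.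
[cite: Ligozat1975, Ch. 4] [cite: Koehler2011, §1] [cite: CremonaAlgorithms1997, Table 1 (24a1)] [cite: SilvermanATAEC1994, IV.5.1]
-/

set_option autoImplicit false
-- lint-debt: the directory name repeats the summit name (sibling precedent `ManinLocalTwoThreeLigozatIdentitiesThirtySix.lean`)
set_option linter.dupNamespace false

noncomputable section

open Complex Filter Topology Set Asymptotics Polynomial
open UpperHalfPlane hiding I
open scoped Real Topology Manifold MatrixGroups
open Literature.NumberTheory.EllipticCurves Literature.NumberTheory.EllipticCurves.ModularForms

namespace Summit.BirchSwinnertonDyer.BirchSwinnertonDyer.Theorems.ManinLocalTwoThree.EtaIdentitiesTwentyFour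

open QRemainder EulerRemainders EulerRemaindersTwentyFour

/-! ## §0 `E₄ = 1 − q⁴ + o(q⁶)`, `E₄′`, `E₆′` modulo `o(q⁶)` (the level-`24` Euler remainders not already in the tree) -/

/-- The first seven `q`-coefficients of `E₄`: `1, 0, 0, 0, −1, 0, 0`. [folklore] -/
theorem coeff_formalEulerScaled_four (n : ℕ) (hn : n ≤ 6) :
    PowerSeries.coeff n (formalEulerScaled 4) = if n = 0 then 1 else if n = 4 then -1 else 0 := by
  obtain ⟨h0, h1, -⟩ := coeff_formalEulerPow_one_of_le_two
  interval_cases n <;> simp +decide [coeff_formalEulerScaled, h0, h1]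

/-- **`E₄ = 1 − q⁴ + o(q⁶)`.** [folklore] -/
theorem tendsto_eulerFn_four :
    Tendsto (fun τ : ℍ ↦ (eulerFn 4 τ - (1 - X ^ 4 : ℂ[X]).eval (Function.Periodic.qParam 1 (τ : ℂ)))
      / Function.Periodic.qParam 1 (τ : ℂ) ^ 6) atImInfty (𝓝 0) := by
  refine congr_poly ?_ (tendsto_of_hasSum (periodic_eulerFn 4) (mdifferentiable_eulerFn 4)
    (isBoundedAtImInfty_eulerFn (by norm_num)) (hasSum_eulerFn (by norm_num)) 6)
  have h := coeff_formalEulerScaled_four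
  simp only [Finset.sum_range_succ, Finset.sum_range_zero, h 0 (by norm_num), h 1 (by norm_num), h 2 (by norm_num),
    h 3 (by norm_num), h 4 (by norm_num), h 5 (by norm_num), h 6 (by norm_num)]
  norm_num
  ring

/-- **`E₄′ = 2πi(−4q⁴) + o(q⁶)`.** [folklore] -/
theorem tendsto_deriv_eulerFn_four :
    Tendsto (fun τ : ℍ ↦ (deriv (eulerFn 4 ∘ ofComplex) τ
      - (C (2 * π * I) * (-4 * X ^ 4) : ℂ[X]).eval (Function.Periodic.qParam 1 (τ : ℂ)))
      / Function.Periodic.qParam 1 (τ : ℂ) ^ 6) atImInfty (𝓝 0) := by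
  refine congr_poly ?_ (congr_fun (fun τ ↦ deriv_eulerFn_sub_one 4 τ)
    (tendsto_deriv_of_isCuspFunction (isCuspFunction_eulerFn_sub_one (by norm_num : 0 < 4)) 6))
  have h := coeff_formalEulerScaled_four
  have hc : ∀ n : ℕ, n ≠ 0 → n ≤ 6 → (qExpansion 1 (eulerFn 4 - 1)).coeff n
      = (((if n = 0 then 1 else if n = 4 then -1 else 0 : ℤ)) : ℂ) :=
    fun n hn hn6 ↦ by rw [qExpansion_eulerFn_sub_one_coeff_of_ne_zero (by norm_num) hn, h n hn6]
  simp only [Finset.sum_range_succ, Finset.sum_range_zero, hc 1 one_ne_zero (by norm_num),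
    hc 2 (by norm_num) (by norm_num), hc 3 (by norm_num) (by norm_num), hc 4 (by norm_num) (by norm_num),
    hc 5 (by norm_num) (by norm_num), hc 6 (by norm_num) (by norm_num)]
  norm_num
  simp only [map_ofNat]
  ring

/-- **`E₆′ = 2πi(−6q⁶) + o(q⁶)`.** [folklore] -/
theorem tendsto_deriv_eulerFn_six :
    Tendsto (fun τ : ℍ ↦ (deriv (eulerFn 6 ∘ ofComplex) τ
      - (C (2 * π * I) * (-6 * X ^ 6) : ℂ[X]).eval (Function.Periodic.qParam 1 (τ : ℂ)))
      / Function.Periodic.qParam 1 (τ : ℂ) ^ 6) atImInfty (𝓝 0) := by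
  refine congr_poly ?_ (congr_fun (fun τ ↦ deriv_eulerFn_sub_one 6 τ)
    (tendsto_deriv_of_isCuspFunction (isCuspFunction_eulerFn_sub_one (by norm_num : 0 < 6)) 6))
  have h := LigozatIdentitiesThirtySix.coeff_formalEulerScaled_six
  have hc : ∀ n : ℕ, n ≠ 0 → n ≤ 6 → (qExpansion 1 (eulerFn 6 - 1)).coeff n
      = (((if n = 0 then 1 else if n = 6 then -1 else 0 : ℤ)) : ℂ) :=
    fun n hn hn6 ↦ by rw [qExpansion_eulerFn_sub_one_coeff_of_ne_zero (by norm_num) hn, h n hn6]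
  simp only [Finset.sum_range_succ, Finset.sum_range_zero, hc 1 one_ne_zero (by norm_num),
    hc 2 (by norm_num) (by norm_num), hc 3 (by norm_num) (by norm_num), hc 4 (by norm_num) (by norm_num),
    hc 5 (by norm_num) (by norm_num), hc 6 (by norm_num) (by norm_num)]
  norm_num
  simp only [map_ofNat]
  ring

/-! ## §1 The `q`-asymptotics (T1), (T2), (T3) at `i∞` -/

/-- **(T1)₂₄**: `((2πi)⁻¹x′ + φ₂₄·2y)/q → 0` at `i∞`. [cite: Ligozat1975, Ch. 4] -/
theorem tendsto_T1 :
    Tendsto (fun τ : ℍ ↦ ((2 * π * I)⁻¹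
      * deriv (etaQuotient 24 (expFn [(2, -1), (6, 3), (8, 1), (24, -3)]) ∘ ofComplex) τ
      + cuspFormEta24 τ * (2 * etaQuotient 24 (expFn [(2, -1), (4, 1), (6, -1), (8, 2), (12, 5), (24, -6)]) τ))
      / Function.Periodic.qParam 1 (τ : ℂ)) atImInfty (𝓝 0) := by
  have h2pi : (2 * π * I : ℂ) ≠ 0 := by simp [Real.pi_ne_zero, I_ne_zero]
  have hE2 := EulerRemaindersTwenty.tendsto_eulerFn_two
  have hE4 := tendsto_eulerFn_four
  have hE6 := LigozatIdentitiesThirtySix.tendsto_eulerFn_six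
  have hE8 := tendsto_eulerFn (δ := 8) (m := 6) (by norm_num)
  have hE12 := tendsto_eulerFn (δ := 12) (m := 6) (by norm_num)
  have hE24 := tendsto_eulerFn (δ := 24) (m := 6) (by norm_num)
  -- `T_δ = (2πi)⁻¹ E_δ′`
  have hT2 := QRemainder.congr_poly (P' := -2 * X ^ 2 - 4 * X ^ 4)
    (by rw [← mul_assoc, ← map_mul, inv_mul_cancel₀ h2pi, map_one, one_mul]) (QRemainder.const_mul (2 * π * I)⁻¹ EulerRemaindersTwenty.tendsto_deriv_eulerFn_two)
  have hT6 := QRemainder.congr_poly (P' := -6 * X ^ 6)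
    (by rw [← mul_assoc, ← map_mul, inv_mul_cancel₀ h2pi, map_one, one_mul]) (QRemainder.const_mul (2 * π * I)⁻¹ tendsto_deriv_eulerFn_six)
  have hT8 := QRemainder.congr_poly (P' := 0) (by rw [mul_zero])
    (QRemainder.const_mul (2 * π * I)⁻¹ (tendsto_deriv_eulerFn (δ := 8) (m := 6) (by norm_num)))
  have hT24 := QRemainder.congr_poly (P' := 0) (by rw [mul_zero])
    (QRemainder.const_mul (2 * π * I)⁻¹ (tendsto_deriv_eulerFn (δ := 24) (m := 6) (by norm_num)))
  -- `G₁ = E₆²E₂₄²(3T₆E₈E₂E₂₄ + T₈E₆E₂E₂₄ − 2E₆E₈E₂E₂₄ − T₂E₆E₈E₂₄ − 3T₂₄E₆E₈E₂) + 2E₂²E₄²E₈²E₁₂⁶ = o(q⁶)`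
  have hA := QRemainder.mul (QRemainder.mul (QRemainder.mul (QRemainder.const_mul 3 hT6) hE8) hE2) hE24
  have hB := QRemainder.mul (QRemainder.mul (QRemainder.mul hT8 hE6) hE2) hE24
  have hC := QRemainder.mul (QRemainder.mul (QRemainder.mul (QRemainder.const_mul 2 hE6) hE8) hE2) hE24
  have hD := QRemainder.mul (QRemainder.mul (QRemainder.mul hT2 hE6) hE8) hE24
  have hE := QRemainder.mul (QRemainder.mul (QRemainder.mul (QRemainder.const_mul 3 hT24) hE6) hE8) hE2
  have h1 := QRemainder.mul (QRemainder.mul (QRemainder.pow hE6 2) (QRemainder.pow hE24 2))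
    (QRemainder.sub (QRemainder.sub (QRemainder.sub (QRemainder.add hA hB) hC) hD) hE)
  have h2 := QRemainder.mul (QRemainder.mul (QRemainder.mul (QRemainder.const_mul 2 (QRemainder.pow hE2 2)) (QRemainder.pow hE4 2))
    (QRemainder.pow hE8 2)) (QRemainder.pow hE12 6)
  have hG := QRemainder.reduce 0
    (14 * X - 12 * X ^ 3 + 24 * X ^ 5 - 20 * X ^ 7 - 16 * X ^ 9 - 16 * X ^ 11 + 14 * X ^ 13 + 12 * X ^ 15)
    (by simp only [map_ofNat]; ring) (QRemainder.add h1 h2)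
  have hlim := (QRemainder.tendsto_div_pow 3 (by norm_num) hG).mul
    ((((isIntUnitQExp_eulerFn (by norm_num : 0 < 2)).tendsto_one.pow 2).mul
      ((isIntUnitQExp_eulerFn (by norm_num : 0 < 24)).tendsto_one.pow 6)).inv₀ (by norm_num))
  rw [zero_mul] at hlim
  refine hlim.congr fun τ ↦ ?_
  have hE2' := eulerFn_ne_zero (by norm_num : 0 < 2) τ
  have hE6' := eulerFn_ne_zero (by norm_num : 0 < 6) τ
  have hE8' := eulerFn_ne_zero (by norm_num : 0 < 8) τ
  have hE24' := eulerFn_ne_zero (by norm_num : 0 < 24) τ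
  have hq := qParam_ne_zero τ
  rw [deriv_x24, y24_eq, etaProductTwentyFour_eq]
  field_simp

/-- **(T2)₂₄**: `((2πi)⁻¹y′ + φ₂₄(3x² − 2x − 4))/q → 0` at `i∞`. [cite: Ligozat1975, Ch. 4] -/
theorem tendsto_T2 :
    Tendsto (fun τ : ℍ ↦ ((2 * π * I)⁻¹
      * deriv (etaQuotient 24 (expFn [(2, -1), (4, 1), (6, -1), (8, 2), (12, 5), (24, -6)]) ∘ ofComplex) τ
      + cuspFormEta24 τ * (3 * etaQuotient 24 (expFn [(2, -1), (6, 3), (8, 1), (24, -3)]) τ ^ 2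
        - 2 * etaQuotient 24 (expFn [(2, -1), (6, 3), (8, 1), (24, -3)]) τ - 4))
      / Function.Periodic.qParam 1 (τ : ℂ)) atImInfty (𝓝 0) := by
  have h2pi : (2 * π * I : ℂ) ≠ 0 := by simp [Real.pi_ne_zero, I_ne_zero]
  have hE2 := EulerRemaindersTwenty.tendsto_eulerFn_two
  have hE4 := tendsto_eulerFn_four
  have hE6 := LigozatIdentitiesThirtySix.tendsto_eulerFn_six
  have hE8 := tendsto_eulerFn (δ := 8) (m := 6) (by norm_num)
  have hE12 := tendsto_eulerFn (δ := 12) (m := 6) (by norm_num)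
  have hE24 := tendsto_eulerFn (δ := 24) (m := 6) (by norm_num)
  have hT2 := QRemainder.congr_poly (P' := -2 * X ^ 2 - 4 * X ^ 4)
    (by rw [← mul_assoc, ← map_mul, inv_mul_cancel₀ h2pi, map_one, one_mul]) (QRemainder.const_mul (2 * π * I)⁻¹ EulerRemaindersTwenty.tendsto_deriv_eulerFn_two)
  have hT4 := QRemainder.congr_poly (P' := -4 * X ^ 4)
    (by rw [← mul_assoc, ← map_mul, inv_mul_cancel₀ h2pi, map_one, one_mul]) (QRemainder.const_mul (2 * π * I)⁻¹ tendsto_deriv_eulerFn_four)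
  have hT6 := QRemainder.congr_poly (P' := -6 * X ^ 6)
    (by rw [← mul_assoc, ← map_mul, inv_mul_cancel₀ h2pi, map_one, one_mul]) (QRemainder.const_mul (2 * π * I)⁻¹ tendsto_deriv_eulerFn_six)
  have hT8 := QRemainder.congr_poly (P' := 0) (by rw [mul_zero])
    (QRemainder.const_mul (2 * π * I)⁻¹ (tendsto_deriv_eulerFn (δ := 8) (m := 6) (by norm_num)))
  have hT12 := QRemainder.congr_poly (P' := 0) (by rw [mul_zero])
    (QRemainder.const_mul (2 * π * I)⁻¹ (tendsto_deriv_eulerFn (δ := 12) (m := 6) (by norm_num)))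
  have hT24 := QRemainder.congr_poly (P' := 0) (by rw [mul_zero])
    (QRemainder.const_mul (2 * π * I)⁻¹ (tendsto_deriv_eulerFn (δ := 24) (m := 6) (by norm_num)))
  -- inner = T₄E₈E₁₂E₂E₆E₂₄ + 2T₈E₄E₁₂E₂E₆E₂₄ + 5T₁₂E₄E₈E₂E₆E₂₄ − 3E₄E₈E₁₂E₂E₆E₂₄ − T₂E₄E₈E₁₂E₆E₂₄ − T₆E₄E₈E₁₂E₂E₂₄ − 6T₂₄E₄E₈E₁₂E₂E₆
  have hA := QRemainder.mul (QRemainder.mul (QRemainder.mul (QRemainder.mul (QRemainder.mul hT4 hE8) hE12) hE2) hE6) hE24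
  have hB := QRemainder.mul (QRemainder.mul (QRemainder.mul (QRemainder.mul (QRemainder.mul (QRemainder.const_mul 2 hT8) hE4) hE12) hE2) hE6) hE24
  have hC := QRemainder.mul (QRemainder.mul (QRemainder.mul (QRemainder.mul (QRemainder.mul (QRemainder.const_mul 5 hT12) hE4) hE8) hE2) hE6) hE24
  have hD := QRemainder.mul (QRemainder.mul (QRemainder.mul (QRemainder.mul (QRemainder.mul (QRemainder.const_mul 3 hE4) hE8) hE12) hE2) hE6) hE24
  have hE := QRemainder.mul (QRemainder.mul (QRemainder.mul (QRemainder.mul (QRemainder.mul hT2 hE4) hE8) hE12) hE6) hE24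
  have hF := QRemainder.mul (QRemainder.mul (QRemainder.mul (QRemainder.mul (QRemainder.mul hT6 hE4) hE8) hE12) hE2) hE24
  have hK := QRemainder.mul (QRemainder.mul (QRemainder.mul (QRemainder.mul (QRemainder.mul (QRemainder.const_mul 6 hT24) hE4) hE8) hE12) hE2) hE6
  have hinner := QRemainder.sub (QRemainder.sub (QRemainder.sub (QRemainder.sub (QRemainder.add (QRemainder.add hA hB) hC) hD) hE) hF) hK
  -- `G₂ = E₈E₁₂⁴·inner + 3E₄E₆⁹E₈²E₁₂E₂E₂₄ − 2q²E₄E₆⁶E₈E₁₂E₂²E₂₄⁴ − 4q⁴E₂³E₄E₆³E₁₂E₂₄⁷ = o(q⁶)`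
  have h1 := QRemainder.mul (QRemainder.mul hE8 (QRemainder.pow hE12 4)) hinner
  have h2 := QRemainder.mul (QRemainder.mul (QRemainder.mul (QRemainder.mul (QRemainder.mul
    (QRemainder.const_mul 3 hE4) (QRemainder.pow hE6 9)) (QRemainder.pow hE8 2)) hE12) hE2) hE24
  have h3 := QRemainder.const_mul 2 (QRemainder.qParam_pow_mul 2 (QRemainder.mul (QRemainder.mul (QRemainder.mul (QRemainder.mul
    (QRemainder.mul hE4 (QRemainder.pow hE6 6)) hE8) hE12) (QRemainder.pow hE2 2)) (QRemainder.pow hE24 4)))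
  have h4 := QRemainder.const_mul 4 (QRemainder.qParam_pow_mul 4 (QRemainder.mul (QRemainder.mul (QRemainder.mul (QRemainder.mul
    (QRemainder.pow hE2 3) hE4) (QRemainder.pow hE6 3)) hE12) (QRemainder.pow hE24 7)))
  have hG := QRemainder.reduce 0
    (24 * X - 12 * X ^ 3 + 32 * X ^ 5 - 86 * X ^ 7 - 44 * X ^ 9 - 84 * X ^ 11 + 180 * X ^ 13 + 260 * X ^ 15 + 130 * X ^ 17
      - 366 * X ^ 19 - 572 * X ^ 21 - 56 * X ^ 23 + 564 * X ^ 25 + 668 * X ^ 27 - 78 * X ^ 29 - 550 * X ^ 31 - 476 * X ^ 33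
      + 124 * X ^ 35 + 340 * X ^ 37 + 212 * X ^ 39 - 77 * X ^ 41 - 133 * X ^ 43 - 54 * X ^ 45 + 24 * X ^ 47 + 30 * X ^ 49
      + 6 * X ^ 51 - 3 * X ^ 53 - 3 * X ^ 55)
    (by simp only [map_ofNat]; ring) (QRemainder.sub (QRemainder.sub (QRemainder.add h1 h2) h3) h4)
  have hlim := (QRemainder.tendsto_div_pow 4 (by norm_num) hG).mul
    (((((isIntUnitQExp_eulerFn (by norm_num : 0 < 2)).tendsto_one.pow 2).mul
      ((isIntUnitQExp_eulerFn (by norm_num : 0 < 6)).tendsto_one.pow 2)).mul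
      ((isIntUnitQExp_eulerFn (by norm_num : 0 < 24)).tendsto_one.pow 7)).inv₀ (by norm_num))
  rw [zero_mul] at hlim
  refine hlim.congr fun τ ↦ ?_
  have hE2' := eulerFn_ne_zero (by norm_num : 0 < 2) τ
  have hE4' := eulerFn_ne_zero (by norm_num : 0 < 4) τ
  have hE6' := eulerFn_ne_zero (by norm_num : 0 < 6) τ
  have hE8' := eulerFn_ne_zero (by norm_num : 0 < 8) τ
  have hE12' := eulerFn_ne_zero (by norm_num : 0 < 12) τ
  have hE24' := eulerFn_ne_zero (by norm_num : 0 < 24) τ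
  have hq := qParam_ne_zero τ
  rw [deriv_y24, x24_eq, etaProductTwentyFour_eq]
  field_simp
  ring

/-- **(T3)₂₄**: `x³ − x² − 4x + 4 − y² → 0` at `i∞`. [cite: Ligozat1975, Ch. 4] -/
theorem tendsto_T3 :
    Tendsto (fun τ : ℍ ↦ etaQuotient 24 (expFn [(2, -1), (6, 3), (8, 1), (24, -3)]) τ ^ 3
      - etaQuotient 24 (expFn [(2, -1), (6, 3), (8, 1), (24, -3)]) τ ^ 2
      - 4 * etaQuotient 24 (expFn [(2, -1), (6, 3), (8, 1), (24, -3)]) τ + 4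
      - etaQuotient 24 (expFn [(2, -1), (4, 1), (6, -1), (8, 2), (12, 5), (24, -6)]) τ ^ 2) atImInfty (𝓝 0) := by
  have hE2 := EulerRemaindersTwenty.tendsto_eulerFn_two
  have hE4 := tendsto_eulerFn_four
  have hE6 := LigozatIdentitiesThirtySix.tendsto_eulerFn_six
  have hE8 := tendsto_eulerFn (δ := 8) (m := 6) (by norm_num)
  have hE12 := tendsto_eulerFn (δ := 12) (m := 6) (by norm_num)
  have hE24 := tendsto_eulerFn (δ := 24) (m := 6) (by norm_num)
  -- `G₃ = E₆¹¹E₈³E₂₄³ − q²E₂E₆⁸E₈²E₂₄⁶ − 4q⁴E₂²E₆⁵E₈E₂₄⁹ + 4q⁶E₂³E₆²E₂₄¹² − E₂E₄²E₈⁴E₁₂¹⁰ = o(q⁶)`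
  have h1 := QRemainder.mul (QRemainder.mul (QRemainder.pow hE6 11) (QRemainder.pow hE8 3)) (QRemainder.pow hE24 3)
  have h2 := QRemainder.qParam_pow_mul 2 (QRemainder.mul (QRemainder.mul (QRemainder.mul hE2 (QRemainder.pow hE6 8))
    (QRemainder.pow hE8 2)) (QRemainder.pow hE24 6))
  have h3 := QRemainder.const_mul 4 (QRemainder.qParam_pow_mul 4 (QRemainder.mul (QRemainder.mul (QRemainder.mul
    (QRemainder.pow hE2 2) (QRemainder.pow hE6 5)) hE8) (QRemainder.pow hE24 9)))
  have h4 := QRemainder.const_mul 4 (QRemainder.qParam_pow_mul 6 (QRemainder.mul (QRemainder.mul (QRemainder.pow hE2 3)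
    (QRemainder.pow hE6 2)) (QRemainder.pow hE24 12)))
  have h5 := QRemainder.mul (QRemainder.mul (QRemainder.mul hE2 (QRemainder.pow hE4 2)) (QRemainder.pow hE8 4)) (QRemainder.pow hE12 10)
  have hG := QRemainder.reduce 0
    (-3 * X + 5 * X ^ 3 + 16 * X ^ 5 - 24 * X ^ 7 + 16 * X ^ 9 - 77 * X ^ 11 + 84 * X ^ 13 - 72 * X ^ 15 + 182 * X ^ 17
      - 110 * X ^ 19 + 118 * X ^ 21 - 316 * X ^ 23 + 76 * X ^ 25 - 92 * X ^ 27 + 378 * X ^ 29 - 32 * X ^ 31 + 36 * X ^ 33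
      - 298 * X ^ 35 + 8 * X ^ 37 - 8 * X ^ 39 + 157 * X ^ 41 - X ^ 43 + X ^ 45 - 54 * X ^ 47 + 11 * X ^ 53 - X ^ 59)
    (by simp only [map_ofNat]; ring) (QRemainder.sub (QRemainder.add (QRemainder.sub (QRemainder.sub h1 h2) h3) h4) h5)
  have hlim := (QRemainder.tendsto_div_pow 6 le_rfl hG).mul
    (((((isIntUnitQExp_eulerFn (by norm_num : 0 < 2)).tendsto_one.pow 3).mul
      ((isIntUnitQExp_eulerFn (by norm_num : 0 < 6)).tendsto_one.pow 2)).mul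
      ((isIntUnitQExp_eulerFn (by norm_num : 0 < 24)).tendsto_one.pow 12)).inv₀ (by norm_num))
  rw [zero_mul] at hlim
  refine hlim.congr fun τ ↦ ?_
  have hE2' := eulerFn_ne_zero (by norm_num : 0 < 2) τ
  have hE6' := eulerFn_ne_zero (by norm_num : 0 < 6) τ
  have hE24' := eulerFn_ne_zero (by norm_num : 0 < 24) τ
  have hq := qParam_ne_zero τ
  rw [x24_eq, y24_eq]
  field_simp

/-! ## §2 The identities, (S2)₂₄, and `|c| = 1` on `X₀(24)` — unconditionally -/

/-- **(I2a)**: `x′ = −2πi φ₂₄ · 2y` on `ℍ`. [cite: Ligozat1975, Ch. 4] -/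
theorem deriv_x24_identity (τ : ℍ) :
    deriv (etaQuotient 24 (expFn [(2, -1), (6, 3), (8, 1), (24, -3)]) ∘ ofComplex) τ
      = -(2 * π * I * cuspFormEta24 τ) * (2 * etaQuotient 24 (expFn [(2, -1), (4, 1), (6, -1), (8, 2), (12, 5), (24, -6)]) τ) :=
  EtaIdentityReductionTwentyFour.deriv_x24_of_tendsto tendsto_T1 τ

/-- **(I2b)**: `y′ = −2πi φ₂₄ · (3x² − 2x − 4)` on `ℍ`. [cite: Ligozat1975, Ch. 4] -/
theorem deriv_y24_identity (τ : ℍ) :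
    deriv (etaQuotient 24 (expFn [(2, -1), (4, 1), (6, -1), (8, 2), (12, 5), (24, -6)]) ∘ ofComplex) τ
      = -(2 * π * I * cuspFormEta24 τ) * (3 * etaQuotient 24 (expFn [(2, -1), (6, 3), (8, 1), (24, -3)]) τ ^ 2
          - 2 * etaQuotient 24 (expFn [(2, -1), (6, 3), (8, 1), (24, -3)]) τ - 4) :=
  EtaIdentityReductionTwentyFour.deriv_y24_of_tendsto tendsto_T2 τ

/-- **(I1): the cubic `y² = x³ − x² − 4x + 4` on `ℍ`** — the `η`-quotients parametrise Cremona's equation of `24a1 = X₀(24)` literally.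
[cite: CremonaAlgorithms1997, Table 1 (24a1)] -/
theorem cubic24 (τ : ℍ) :
    etaQuotient 24 (expFn [(2, -1), (6, 3), (8, 1), (24, -3)]) τ ^ 3 - etaQuotient 24 (expFn [(2, -1), (6, 3), (8, 1), (24, -3)]) τ ^ 2
      - 4 * etaQuotient 24 (expFn [(2, -1), (6, 3), (8, 1), (24, -3)]) τ + 4
      = etaQuotient 24 (expFn [(2, -1), (4, 1), (6, -1), (8, 2), (12, 5), (24, -6)]) τ ^ 2 :=
  EtaIdentityReductionTwentyFour.cubic24_of_deriv deriv_x24_identity deriv_y24_identity tendsto_T3 τ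

/-- **(S2)₂₄ unconditionally**: the period lattice of `φ₂₄ = η(2τ)η(4τ)η(6τ)η(12τ)` lies in the Néron lattice shape of `24a1`,
`Λ(52/3, −280/27)`. [cite: CremonaAlgorithms1997, §2.10] -/
theorem periodLatticeLe_twentyFour :
    ∃ L₁ : PeriodPair, L₁.g₂ = 52 / 3 ∧ L₁.g₃ = -(280 / 27) ∧ ∀ z ∈ periodLattice cuspFormEta24, z ∈ L₁.lattice :=
  EtaIdentityReductionTwentyFour.periodLatticeLe24_of_etaIdentities cubic24 deriv_x24_identity

/-- **`|c| = 1` on `X₀(24)`, unconditionally** (the NÉRON SQUEEZE at the non-CM level `24`): for every globally minimal elliptic `W/ℚ` and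
every `X₀(24)`-parametrisation datum `D` of `W` with the lattice clause `Λ_W = c·Λ_f`, `|c| = 1` — no modularity, CDT or printed
Manin-constant fact is assumed. [cite: CremonaAlgorithms1997, Table 1 (24a1)] [cite: SilvermanATAEC1994, IV.5.1, Cor. IV.9.1] -/
theorem abs_maninConstant_eq_one_twentyFour (W : WeierstrassCurve ℚ) [W.IsElliptic] [W.IsGloballyMinimal]
    (D : ModularParametrizationData W 24)
    (hopt : ∀ z ∈ D.L.lattice, ∃ w ∈ periodLattice D.f, z = D.c * w) :
    |D.maninConstant| = 1 :=
  LevelTwentyFour.abs_maninConstant_eq_one_twentyFour_of_periodLattice_le periodLatticeLe_twentyFour W D hopt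

/-- **`2 ∤ c` on `X₀(24)`, unconditionally** — the shape of the crux C2 `ManinOddAtFour` at the level `N = 24` (`2² ∣ 24`), with none of its four
fact hypotheses. [cite: CremonaAlgorithms1997, Table 1 (24a1)] -/
theorem not_two_dvd_maninConstant_twentyFour (W : WeierstrassCurve ℚ) [W.IsElliptic] [W.IsGloballyMinimal]
    (D : ModularParametrizationData W 24)
    (hopt : ∀ z ∈ D.L.lattice, ∃ w ∈ periodLattice D.f, z = D.c * w) :
    ¬ (2 : ℤ) ∣ D.maninConstant :=
  LevelTwentyFour.not_two_dvd_maninConstant_twentyFour_of_periodLattice_le periodLatticeLe_twentyFour W D hopt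

/-- **Under the item's own modularity binder alone: a lattice-optimal `X₀(24)`-datum EXISTS and EVERY such datum has `|c| = 1`** (C2's
binder block at `24` is inhabited relative to `exists_isNewformOf`, `LevelTwentyFour.maninOddAtFour_domain_inhabited_twentyFour_of_modularity`;
the conclusion is unconditional). [cite: DiamondShurman2005, Thm. 8.8.3] [cite: EdixhovenManin1991, Prop. 2] -/
theorem maninOddAtFour_twentyFour_of_modularity (hnf : exists_isNewformOf) :
    (∃ (W₀ : WeierstrassCurve ℚ) (_ : W₀.IsElliptic) (_ : W₀.IsGloballyMinimal) (D₀ : ModularParametrizationData W₀ 24),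
      (∀ z ∈ D₀.L.lattice, ∃ w ∈ periodLattice D₀.f, z = D₀.c * w) ∧ 2 ^ 2 ∣ 24) ∧
    ∀ (W : WeierstrassCurve ℚ) [W.IsElliptic] [W.IsGloballyMinimal] (D : ModularParametrizationData W 24),
      (∀ z ∈ D.L.lattice, ∃ w ∈ periodLattice D.f, z = D.c * w) → |D.maninConstant| = 1 ∧ ¬ (2 : ℤ) ∣ D.maninConstant := by
  refine ⟨?_, fun W _ _ D hopt ↦ ⟨abs_maninConstant_eq_one_twentyFour W D hopt, not_two_dvd_maninConstant_twentyFour W D hopt⟩⟩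
  obtain ⟨W₀, h₀, hmin, D₀, -, hopt, h4⟩ := LevelTwentyFour.maninOddAtFour_domain_inhabited_twentyFour_of_modularity hnf
  exact ⟨W₀, h₀, hmin, D₀, hopt, h4⟩

end Summit.BirchSwinnertonDyer.BirchSwinnertonDyer.Theorems.ManinLocalTwoThree.EtaIdentitiesTwentyFour

end
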